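/-
COR-CM (cell pub-hodgecm2, stage 2 of the Hodge ladder).  AUTHORED by seat b01-idea-1 gen 7 (planner-pub-hodgecm2-b01-idea-1-g7-0):
this file is §4, §6, §8 and §9 (first two theorems) of `HOME/b01/IDEA-1g-Sketch.lean` (md5 2b886ef99c24d700a567e7548b163aeb, farm rc 0),
FILED by seat b06 gen 22 (lane V-TRANSPORT, OFFER ORBIT-ASSEMBLY, INBOX 2026-08-21T11:52:52Z) with these mechanical edits only:
(a) the displayed row `def Universe.TwistSemilinear : Prop` is NOT declared — its content is stated and proved directly as the
`∃`-theorems `Model.universeOf_exists_twistIsogeny` / `Model.exists_twistIsogeny`, and `Universe.periodNV_twist` takes the twist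
isogenies as an explicit `∃`-hypothesis; (b) section headers/docstrings renumbered; (c) this header.  Count-neutral: no BINDER-OWNERS
row, no E term, no display of record, `Interfaces.lean` (C1) untouched.
Wording of record (verbatim, unchanged by this file): HC_CM follows in the kernel from BallQuotientUniformised ∧ PerLFace(model universe of record).
-/
import Summits.HodgeConjecture.CorCM.FaceSquareSymmetry
import Summits.HodgeConjecture.CorCM.Proofs.Prop22.Basic
import Summits.HodgeConjecture.CorCM.CM.Lemmas
import HarnessLib

/-!
# COR-CM — the Galois twist of CM types, faces and face periods on the universe of record

For a CM field `K`, `g ∈ Aut K` and a CM type `Φ`, write `Φ^g = cmTypeMap g Φ = {s | s ∘ g ∈ Φ}`.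

* §1 `Universe.periodNV_twist` — on any universe with `Fact_pull_comp`, `Fact_alphaLine` and `g`-semilinear twist isogenies
  `u : A_{(K,Ψ)} → A_{(K,Ψ^g)}` (`u^*` bijective on `H¹(ℚ)`, `u^* ∘ ι_{Ψ^g}(b) = ι_Ψ(g⁻¹ b) ∘ u^*`):
  `PeriodNV ι₁ V K Ψ σ → PeriodNV ι₁ V K Ψ^g (σ ∘ g⁻¹)` on the SAME Picard modular surface (maps `u_i ∘ F_i`, forms `(u_i^*)⁻¹ α_i`,
  period literally unchanged);
* §2 `Face.twist g f = (Φ^g; g π, g π′)` with `twist_psi` (the period types of the twisted face are the twisted period types) and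
  `twist_admissible_iff`;
* §3 **`Model.exists_twistIsogeny`** — the twist isogenies EXIST on the universe of record `Model.picardCMUniverse hHD hI h₁ h₃`
  (Shimura 1998 §6.1 Corollary of Thm 2 via the tree theorems `thm2_cor_of_riemann`, `deligneMilne1982_Thm_6_20_full_holds`; the
  pattern of `Model.var_conjIsogeny`, row M25, with conjugation replaced by `g`);
* §4 **`Model.periodNV_twist`**, **`Model.periodNV_face_twist`** — UNCONDITIONAL on the universe of record: a non-zero face period
  for `(f, ι₁)` on `S_Γ(V)` gives one for `(f^g, ι₁ ∘ g⁻¹)` on the same surface.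

Consumer: `CorCM/FacePeriodOrbit.lean` (IDEA-1g's orbit normal form: with the tower transports `TowerTransport` (row A) /
`TowerRelabel` (row B) and b07's character transport `PeriodCharacterTransport` (row C), ONE non-zero face period per `Aut F`-orbit
of type squares yields every instance of `PeriodThmF` over `F`).  One structure-valued `def` (`Face.twist`), theorems otherwise.
-/

noncomputable section

open scoped TensorProduct
open NumberField
open Literature.AlgebraicGeometry.Motives (CMType HodgeStructure)
open Literature.AlgebraicGeometry.Motives.HodgeStructure (conj ofRat)
open Literature.NumberTheory.ComplexMultiplication.CMTypeOps
open Literature.AlgebraicGeometry.HodgeTheory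
open Literature.NumberTheory.Automorphic.PicardCM
open Literature.NumberTheory.Automorphic.PicardCM.CMCode (cmTypeMap mem_cmTypeMap_iff)

namespace Summit.HodgeConjecture.CorCM

namespace Universe

variable {U : Universe}

/-! ### §1 Twist transport of `PeriodNV` along a semilinear twist isogeny (IDEA-1g-Sketch §4) -/

/-- `σ ∘ g⁻¹ ∈ Φ^g ↔ σ ∈ Φ` (any field `K`). [folklore] -/
theorem comp_symm_mem_cmTypeMap_iff {K : Type} [Field K] (g : K ≃+* K) (Φ : CMType K) (σ : K →+* ℂ) :
    σ.comp g.symm.toRingHom ∈ (cmTypeMap g Φ).1 ↔ σ ∈ Φ.1 := by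
  rw [mem_cmTypeMap_iff]
  have : (σ.comp g.symm.toRingHom).comp g.toRingHom = σ := RingHom.ext fun x => by simp
  rw [this]

/-- **Twist transport.**  `PeriodNV ι₁ V K Ψ σ` with `σ ∈ Ψ_i` for all `i` gives `PeriodNV ι₁ V K Ψ^g (σ ∘ g⁻¹)` on the SAME tower:
maps `u_i ∘ F_i`, forms `(u_i^*)⁻¹ α_i` (eigencharacter `σ ∘ g⁻¹` by the semilinearity clause; holomorphic by `Fact_alphaLine`,
since `σ ∘ g⁻¹ ∈ Ψ_i^g`), period literally unchanged.  The twist isogenies `u_i` are the hypothesis `hTw` (on the universe of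
record: `Model.exists_twistIsogeny`).  (IDEA-1g-Sketch §4, b01-idea-1 gen 7.) [folklore] -/
theorem periodNV_twist (hc : U.Fact_pull_comp) (hal : U.Fact_alphaLine)
    {L : CMField} {ι₁ : L →+* ℂ} {V : HermSpace3 L ι₁} {K : CMField} {Ψ : Fin 4 → CMType K} {σ : K →+* ℂ}
    (g : K ≃+* K)
    (hTw : ∀ Φ : CMType K, ∃ u : U.Mor (U.cmAV K Φ) (U.cmAV K (cmTypeMap g Φ)), Function.Bijective (U.pull u 1) ∧
      ∀ b : K, U.pull u 1 ∘ₗ (U.cmAct K (cmTypeMap g Φ)).ι b = (U.cmAct K Φ).ι (g.symm b) ∘ₗ U.pull u 1)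
    (hσ : ∀ i, σ ∈ (Ψ i).1) (h : U.PeriodNV ι₁ V K Ψ σ) :
    U.PeriodNV ι₁ V K (fun i => cmTypeMap g (Ψ i)) (σ.comp g.symm.toRingHom) := by
  obtain ⟨Γ, F, α, hα, hper⟩ := h
  choose u hub hus using fun i => hTw (Ψ i)
  choose v hv1 hv2 using fun i => baseChange_inverse (U.pull (u i) 1) (hub i)
  have hva : ∀ i, U.pullC (u i) 1 (v i (α i)) = α i := fun i => hv1 i (α i)
  refine ⟨Γ, fun i => U.comp (F i) (u i), fun i => v i (α i), fun i => ?_, ?_⟩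
  · -- the transported form is a holomorphic `σ ∘ g⁻¹`-eigenform
    rw [(hal K _ _).1 ((comp_symm_mem_cmTypeMap_iff g (Ψ i) σ).2 (hσ i)), mem_eigenLine_iff]
    intro b
    have hαe : α i ∈ U.eigenLine K (Ψ i) σ := by
      rw [← (hal K (Ψ i) σ).1 (hσ i)]; exact hα i
    have key : ((U.cmAct K (Ψ i)).ι (g.symm b)).baseChange ℂ (α i) = σ (g.symm b) • α i :=
      (mem_eigenLine_iff.1 hαe) (g.symm b)
    have hinj : Function.Injective (U.pullC (u i) 1) := Function.LeftInverse.injective (hv2 i)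
    apply hinj
    have step : U.pullC (u i) 1 (((U.cmAct K (cmTypeMap g (Ψ i))).ι b).baseChange ℂ (v i (α i))) =
        ((U.cmAct K (Ψ i)).ι (g.symm b)).baseChange ℂ (U.pullC (u i) 1 (v i (α i))) := by
      show (U.pull (u i) 1).baseChange ℂ _ = _
      rw [baseChange_baseChange_of_comp_eq (hus i b), LinearMap.baseChange_comp]; rfl
    rw [map_smul, step, hva i, key]
    rfl
  · -- the period is unchanged
    have h1 : (fun i => U.pullC (U.comp (F i) (u i)) 1 (v i (α i))) = fun i => U.pullC (F i) 1 (α i) := by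
      funext i; rw [pullC_comp_apply hc]; exact congrArg (U.pullC (F i) 1) (hva i)
    rw [h1]; exact hper

end Universe

/-! ### §2 The Galois twist of a face (IDEA-1g-Sketch §6) -/

namespace Face

variable {K : Type} [Field K]

/-- `ψ ∘ g = p ↔ ψ = p ∘ g⁻¹`. -/
theorem comp_eq_iff_eq_comp_symm (g : K ≃+* K) (ψ p : K →+* ℂ) :
    ψ.comp g.toRingHom = p ↔ ψ = p.comp g.symm.toRingHom := by
  constructor
  · rintro rfl; exact RingHom.ext fun x => by simp
  · rintro rfl; exact RingHom.ext fun x => by simp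

/-- `placeSet` is transported by `g`: `ψ ∈ {p ∘ g⁻¹, \overline{p ∘ g⁻¹}} ↔ ψ ∘ g ∈ {p, p̄}`. -/
theorem mem_placeSet_comp_symm_iff (g : K ≃+* K) (p ψ : K →+* ℂ) :
    ψ ∈ placeSet (p.comp g.symm.toRingHom) ↔ ψ.comp g.toRingHom ∈ placeSet p := by
  simp only [placeSet, Set.mem_insert_iff, Set.mem_singleton_iff]
  rw [comp_eq_iff_eq_comp_symm, comp_eq_iff_eq_comp_symm]
  rfl

/-- **Flips commute with the Galois twist of types:** `(Φ^{(p)})^g = (Φ^g)^{(p ∘ g⁻¹)}`. -/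
theorem cmTypeMap_flip (g : K ≃+* K) (p : K →+* ℂ) (Φ : CMType K) :
    cmTypeMap g (flip p Φ) = flip (p.comp g.symm.toRingHom) (cmTypeMap g Φ) := by
  apply Subtype.ext
  ext ψ
  show ψ.comp g.toRingHom ∈ (flip p Φ).1 ↔ ψ ∈ (flip (p.comp g.symm.toRingHom) (cmTypeMap g Φ)).1
  rw [mem_flip_iff, mem_flip_iff, mem_placeSet_comp_symm_iff, mem_cmTypeMap_iff]

/-- **The Galois twist of a face:** `g · (Φ; π, π′) = (Φ^g; g π, g π′)`. -/
def twist (g : K ≃+* K) (f : Face K) : Face K where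
  Φ := cmTypeMap g f.Φ
  p := f.p.comp g.symm.toRingHom
  p' := f.p'.comp g.symm.toRingHom
  place_ne := by
    intro h
    apply f.place_ne
    rcases InfinitePlace.mk_eq_iff.1 h with h1 | h1
    · exact congrArg InfinitePlace.mk ((RingHom.cancel_right g.symm.surjective).1 h1)
    · rw [InfinitePlace.mk_eq_iff]
      exact Or.inr ((RingHom.cancel_right g.symm.surjective).1 h1)

/-- The period types of the twisted face are the twisted period types. -/
theorem twist_psi (g : K ≃+* K) (f : Face K) (i : Fin 4) : (f.twist g).psi i = cmTypeMap g (f.psi i) := by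
  fin_cases i
  · rfl
  · show (flip _ (flip _ (cmTypeMap g f.Φ)) : CMType K) = cmTypeMap g (flip f.p' (flip f.p f.Φ))
    rw [cmTypeMap_flip, cmTypeMap_flip]; rfl
  · show (flip _ (cmTypeMap g f.Φ) : CMType K) = cmTypeMap g (flip f.p f.Φ)
    rw [cmTypeMap_flip]; rfl
  · show (flip _ (cmTypeMap g f.Φ) : CMType K) = cmTypeMap g (flip f.p' f.Φ)
    rw [cmTypeMap_flip]; rfl

/-- `mk (φ ∘ g⁻¹) = mk (ψ ∘ g⁻¹) ↔ mk φ = mk ψ`. -/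
theorem mk_comp_symm_eq_iff (g : K ≃+* K) (φ ψ : K →+* ℂ) :
    InfinitePlace.mk (φ.comp g.symm.toRingHom) = InfinitePlace.mk (ψ.comp g.symm.toRingHom) ↔
      InfinitePlace.mk φ = InfinitePlace.mk ψ := by
  rw [InfinitePlace.mk_eq_iff, InfinitePlace.mk_eq_iff,
    show ComplexEmbedding.conjugate (φ.comp g.symm.toRingHom) = (ComplexEmbedding.conjugate φ).comp g.symm.toRingHom from rfl,
    RingHom.cancel_right g.symm.surjective, RingHom.cancel_right g.symm.surjective]

/-- Admissibility is transported: `ι₁ ∘ g⁻¹` is admissible for `g · f` iff `ι₁` is admissible for `f`. -/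
theorem twist_admissible_iff (g : K ≃+* K) (f : Face K) (ι₁ : K →+* ℂ) :
    (f.twist g).Admissible (ι₁.comp g.symm.toRingHom) ↔ f.Admissible ι₁ := by
  show (ι₁.comp g.symm.toRingHom ∈ (cmTypeMap g f.Φ).1 ∧
      InfinitePlace.mk (ι₁.comp g.symm.toRingHom) ≠ InfinitePlace.mk (f.p.comp g.symm.toRingHom) ∧
      InfinitePlace.mk (ι₁.comp g.symm.toRingHom) ≠ InfinitePlace.mk (f.p'.comp g.symm.toRingHom)) ↔ _
  rw [Universe.comp_symm_mem_cmTypeMap_iff, ne_eq, ne_eq, mk_comp_symm_eq_iff, mk_comp_symm_eq_iff]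
  rfl

end Face

/-! ### §3 The semilinear twist isogeny EXISTS on the universe of record (IDEA-1g-Sketch §8: the proof pattern of the tree's
`Model.var_conjIsogeny`, row M25, with the conjugation `κ` replaced by an arbitrary automorphism; Shimura's Corollary `hcor` is the
tree theorem `thm2_cor_of_riemann deligneMilne1982_Thm_6_20_full_holds`; cf. seat b30's `CyclicSextic.exists_twistIsogeny` on the
Literature carriers) -/

namespace Model

section TwistSemilinear

open CategoryTheory
open Literature.AlgebraicTopology.SingularHomology
open Literature.AlgebraicGeometry.Motives (SchemeOver ComplexPoints IsSmoothProjective bettiCohomology AbelianVariety)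
open Literature.AlgebraicGeometry.ComplexMultiplication

/-- **Semilinear twist isogeny on `PicardCM.Var`** (the tree's `var_conjIsogeny` with `κ` any automorphism of `K`): for codes
`⟨E, Ψ⟩`, `⟨E, Ψ′⟩` over one subfield `E ⊂ ℂ`, `e : K ≃+* E`, `κ : K ≃+* K` with `Ψ′ = Ψ^{(e κ e⁻¹)⁻¹}` (`hΨ`), there is a
morphism `u` of the realised varieties with `u^*` bijective on `H¹(−; ℚ)` and `u^* ∘ ι′(a) = ι(κ a) ∘ u^*`, all `a ∈ K`. -/
theorem var_twistSemilinear (hHD : exists_isReal_hodgeModel) (hI : hodgePQ_independent_of_hodgeModel)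
    (hU : BallQuotientUniformisedDatum) (h₃ : CMAbelianVarietyRealised) (hcor : Shimura1998_Thm2_Cor)
    (E : Subfield ℂ) [NumberField E] [IsCMField E] (Ψ Ψ' : CMType E)
    {K : Type} [Field K] [NumberField K] (e : K ≃+* E) (κ : K ≃+* K)
    (hΨ : ∀ σ : (E : Type) →+* ℂ, σ ∈ Ψ'.1 ↔ σ.comp (e.symm.trans (κ.trans e)).symm.toRingHom ∈ Ψ.1) :
    ∃ u : Var.Mor hU h₃ (.cm ⟨E, Ψ⟩) (.cm ⟨E, Ψ'⟩),
      Function.Bijective (BettiUniverse.pull u 1) ∧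
      ∀ a : K, BettiUniverse.pull u 1 ∘ₗ
          (BettiUniverse.cmEndAction ((cmRealisation h₃ ⟨E, Ψ'⟩).θ.comp e.toRingHom)
            ((cmRealisation h₃ ⟨E, Ψ'⟩).exists_map_comp e) hHD hI
            (Var.isSmoothProjective hU h₃ (.cm ⟨E, Ψ'⟩))).ι a =
        (BettiUniverse.cmEndAction ((cmRealisation h₃ ⟨E, Ψ⟩).θ.comp e.toRingHom)
            ((cmRealisation h₃ ⟨E, Ψ⟩).exists_map_comp e) hHD hI
            (Var.isSmoothProjective hU h₃ (.cm ⟨E, Ψ⟩))).ι (κ a) ∘ₗ BettiUniverse.pull u 1 := by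
  set R := cmRealisation h₃ ⟨E, Ψ⟩ with hR
  set R' := cmRealisation h₃ ⟨E, Ψ'⟩ with hR'
  -- `κ` transported to `E`, and `Ψ'` as the transport of `Ψ` along its inverse
  let κE : (E : Type) ≃+* E := e.symm.trans (κ.trans e)
  have hΨ' : CMCode.cmTypeMap κE.symm Ψ = Ψ' := by
    refine Subtype.ext (Set.ext fun σ ↦ ?_)
    change σ.comp κE.symm.toRingHom ∈ Ψ.1 ↔ σ ∈ Ψ'.1
    exact (hΨ σ).symm
  -- the twisted realisation of `⟨E, Ψ⟩` is a realisation of `Ψ'`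
  have h : IsCMTypeRealisation Ψ R.AV R.ι R.θ := Literature.AlgebraicGeometry.Milne1999.cmRealisation_isCMTypeRealisation h₃ ⟨E, Ψ⟩
  have htw := h.transport κE.symm
  rw [hΨ', RingEquiv.symm_symm] at htw
  have h' : IsCMTypeRealisation Ψ' R'.AV R'.ι R'.θ := Literature.AlgebraicGeometry.Milne1999.cmRealisation_isCMTypeRealisation h₃ ⟨E, Ψ'⟩
  -- Shimura's Corollary + bijectivity of isogenies on `H¹(ℚ)`
  obtain ⟨g, hbij, hequiv⟩ :=
    exists_bettiMap_bijective_equivariant hcor isogeny_bettiMap_bijective_holds Ψ' htw h'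
  refine ⟨g.hom.hom.hom, hbij, ?_⟩
  -- the intertwining, first on the integral basis of `K`
  have hθ := R.exists_map_comp e
  have hθ' := R'.exists_map_comp e
  have key : ∀ b : 𝓞 K,
      BettiUniverse.pull g.hom.hom.hom 1 ∘ₗ BettiUniverse.cmAction (R'.θ.comp e.toRingHom) hθ' (b : K) =
        BettiUniverse.cmAction (R.θ.comp e.toRingHom) hθ (κ b) ∘ₗ BettiUniverse.pull g.hom.hom.hom 1 := by
    intro b
    -- `ι'(e b)^* = cmAction' b` and `ι(κE (e b))^* = cmAction (κ b)` on `H¹(ℚ)`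
    have h1 : BettiUniverse.pull (R'.ι (RingOfIntegers.mapRingEquiv e b)).hom.hom.hom 1 =
        BettiUniverse.cmAction (R'.θ.comp e.toRingHom) hθ' (b : K) :=
      pull_eq_cmAction _ hθ' R'.isSmoothProjective (by
        rw [R'.map_ι, RingOfIntegers.mapRingEquiv_apply]; rfl)
    have h2 : BettiUniverse.pull (R.ι (RingOfIntegers.mapRingEquiv κE (RingOfIntegers.mapRingEquiv e b))).hom.hom.hom 1 =
        BettiUniverse.cmAction (R.θ.comp e.toRingHom) hθ (κ b) :=
      pull_eq_cmAction _ hθ R.isSmoothProjective (by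
        rw [R.map_ι, RingOfIntegers.mapRingEquiv_apply, RingOfIntegers.mapRingEquiv_apply]
        change R.θ (e (κ (e.symm (e (b : K))))) = R.θ (e (κ b))
        rw [RingEquiv.symm_apply_apply])
    rw [← h1, ← h2]
    exact hequiv (RingOfIntegers.mapRingEquiv e b)
  -- extend `ℚ`-linearly from the integral basis
  intro a
  rw [BettiUniverse.cmEndAction_ι, BettiUniverse.cmEndAction_ι]
  let V := bettiCohomology R.A 1
  let V' := bettiCohomology R'.A 1
  let F₁ : K →ₗ[ℚ] (V' →ₗ[ℚ] V) :=
    { toFun := fun x ↦ BettiUniverse.pull g.hom.hom.hom 1 ∘ₗ BettiUniverse.cmAction (R'.θ.comp e.toRingHom) hθ' x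
      map_add' := fun x y ↦ by rw [map_add, LinearMap.comp_add]
      map_smul' := fun q x ↦ by rw [map_smul, LinearMap.comp_smul, RingHom.id_apply] }
  let F₂ : K →ₗ[ℚ] (V' →ₗ[ℚ] V) :=
    { toFun := fun x ↦ BettiUniverse.cmAction (R.θ.comp e.toRingHom) hθ (κ x) ∘ₗ BettiUniverse.pull g.hom.hom.hom 1
      map_add' := fun x y ↦ by rw [map_add, map_add, LinearMap.add_comp]
      map_smul' := fun q x ↦ by rw [map_rat_smul, map_smul, LinearMap.smul_comp, RingHom.id_apply] }
  have hF : F₁ = F₂ := by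
    refine (integralBasis K).ext fun i ↦ ?_
    rw [integralBasis_apply]
    exact key (RingOfIntegers.basis K i)
  exact LinearMap.congr_fun hF a

end TwistSemilinear

/-- **The `g`-semilinear twist isogeny on `universeOf hHD hI hU h₃`** (row T `TwistSemilinear` of IDEA-1g, as an `∃`-theorem)
under Shimura's Corollary `hcor`: for `g ∈ Aut K` there is `u : A_{(K,Φ)} → A_{(K,Φ^g)}` with `u^*` bijective on `H¹(−, ℚ)` and
`u^* ∘ ι_{Φ^g}(b) = ι_Φ(g⁻¹ b) ∘ u^*`; the codes `cmCode K Φ`, `cmCode K Φ^g` share the field `E = (cmEmb K)(K)`; apply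
`var_twistSemilinear` with `κ := g⁻¹`. -/
theorem universeOf_exists_twistIsogeny (hHD : exists_isReal_hodgeModel) (hI : hodgePQ_independent_of_hodgeModel)
    (hU : BallQuotientUniformisedDatum) (h₃ : CMAbelianVarietyRealised)
    (hcor : Literature.AlgebraicGeometry.ComplexMultiplication.Shimura1998_Thm2_Cor) (K : CMField) (Φ : CMType K)
    (g : K ≃+* K) :
    ∃ u : (universeOf hHD hI hU h₃).Mor ((universeOf hHD hI hU h₃).cmAV K Φ) ((universeOf hHD hI hU h₃).cmAV K (cmTypeMap g Φ)),
      Function.Bijective ((universeOf hHD hI hU h₃).pull u 1) ∧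
      ∀ b : K, (universeOf hHD hI hU h₃).pull u 1 ∘ₗ ((universeOf hHD hI hU h₃).cmAct K (cmTypeMap g Φ)).ι b =
        ((universeOf hHD hI hU h₃).cmAct K Φ).ι (g.symm b) ∘ₗ (universeOf hHD hI hU h₃).pull u 1 := by
  have hΨ : ∀ σ : ((cmCode K Φ).E : Type) →+* ℂ,
      σ ∈ (cmCode K (cmTypeMap g Φ)).Φ.1 ↔
        σ.comp ((cmCodeEquiv K Φ).symm.trans (g.symm.trans (cmCodeEquiv K Φ))).symm.toRingHom ∈ (cmCode K Φ).Φ.1 := by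
    intro σ
    change (σ.comp (cmCodeEquiv K Φ).toRingHom).comp g.toRingHom ∈ Φ.1 ↔
      (σ.comp ((cmCodeEquiv K Φ).symm.trans (g.symm.trans (cmCodeEquiv K Φ))).symm.toRingHom).comp
        (cmCodeEquiv K Φ).toRingHom ∈ Φ.1
    refine Iff.of_eq (congrArg (· ∈ Φ.1) (RingHom.ext fun x => ?_))
    simp
  exact @var_twistSemilinear hHD hI hU h₃ hcor (cmCode K Φ).E (cmCode K Φ).isNumberField (cmCode K Φ).isCMField
    (cmCode K Φ).Φ (cmCode K (cmTypeMap g Φ)).Φ K _ _ (cmCodeEquiv K Φ) g.symm hΨ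

/-- **The `g`-semilinear twist isogeny EXISTS on the universe of record `picardCMUniverse hHD hI h₁ h₃`** (row T of IDEA-1g as an
`∃`-theorem; Shimura's Corollary from Riemann's theorem, tree theorems `thm2_cor_of_riemann`, `deligneMilne1982_Thm_6_20_full_holds`):
no hypothesis beyond the universe's own parameters. -/
theorem exists_twistIsogeny (hHD : exists_isReal_hodgeModel) (hI : hodgePQ_independent_of_hodgeModel)
    (h₁ : BallQuotientUniformised) (h₃ : CMAbelianVarietyRealised) (K : CMField) (Φ : CMType K) (g : K ≃+* K) :
    ∃ u : (picardCMUniverse hHD hI h₁ h₃).Mor ((picardCMUniverse hHD hI h₁ h₃).cmAV K Φ)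
        ((picardCMUniverse hHD hI h₁ h₃).cmAV K (cmTypeMap g Φ)),
      Function.Bijective ((picardCMUniverse hHD hI h₁ h₃).pull u 1) ∧
      ∀ b : K, (picardCMUniverse hHD hI h₁ h₃).pull u 1 ∘ₗ ((picardCMUniverse hHD hI h₁ h₃).cmAct K (cmTypeMap g Φ)).ι b =
        ((picardCMUniverse hHD hI h₁ h₃).cmAct K Φ).ι (g.symm b) ∘ₗ (picardCMUniverse hHD hI h₁ h₃).pull u 1 :=
  universeOf_exists_twistIsogeny hHD hI (ballQuotientUniformisedDatum_of h₁) h₃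
    (Literature.AlgebraicGeometry.ComplexMultiplication.thm2_cor_of_riemann deligneMilne1982_Thm_6_20_full_holds) K Φ g

end Model

/-! ### §4 Unconditional twist invariance of `PeriodNV` on the universe of record (IDEA-1g-Sketch §9; rows M01, M14 of
`picardCMUniverse_modelAxioms` + §3) -/

namespace Model

/-- **Twist invariance of face-period non-vanishing on the universe of record — a THEOREM (no displayed hypothesis):**
`PeriodNV ι₁ V K Ψ σ → PeriodNV ι₁ V K Ψ^g (σ ∘ g⁻¹)` for every `g ∈ Aut K`, on the same Picard modular surface. -/
theorem periodNV_twist (hHD : exists_isReal_hodgeModel) (hI : hodgePQ_independent_of_hodgeModel)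
    (h₁ : BallQuotientUniformised) (h₃ : CMAbelianVarietyRealised)
    {L : CMField} {ι₁ : L →+* ℂ} {V : HermSpace3 L ι₁} {K : CMField} {Ψ : Fin 4 → CMType K} {σ : K →+* ℂ}
    (g : K ≃+* K) (hσ : ∀ i, σ ∈ (Ψ i).1) (h : (picardCMUniverse hHD hI h₁ h₃).PeriodNV ι₁ V K Ψ σ) :
    (picardCMUniverse hHD hI h₁ h₃).PeriodNV ι₁ V K (fun i => cmTypeMap g (Ψ i)) (σ.comp g.symm.toRingHom) :=
  Universe.periodNV_twist (picardCMUniverse_modelAxioms hHD hI h₁ h₃).pull_comp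
    (picardCMUniverse_modelAxioms hHD hI h₁ h₃).alphaLine g (fun Φ ↦ exists_twistIsogeny hHD hI h₁ h₃ K Φ g) hσ h

/-- **Face form of twist invariance (THEOREM):** a non-zero face period for `(f, ι₁)` on `S_Γ(V)` gives one for the twisted
face `f^g` at the relabelled embedding `ι₁ ∘ g⁻¹`, on the same surface. -/
theorem periodNV_face_twist (hHD : exists_isReal_hodgeModel) (hI : hodgePQ_independent_of_hodgeModel)
    (h₁ : BallQuotientUniformised) (h₃ : CMAbelianVarietyRealised)
    {F : CMField} (f : Face F) {ι₁ : F →+* ℂ} (hι : f.Admissible ι₁) {V : HermSpace3 F ι₁} (g : F ≃+* F)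
    (h : (picardCMUniverse hHD hI h₁ h₃).PeriodNV ι₁ V F f.psi ι₁) :
    (picardCMUniverse hHD hI h₁ h₃).PeriodNV ι₁ V F (f.twist g).psi (ι₁.comp g.symm.toRingHom) := by
  rw [funext (Face.twist_psi g f)]
  exact periodNV_twist hHD hI h₁ h₃ g (admissible_mem_psi f ι₁ hι) h


end Model

end Summit.HodgeConjecture.CorCM

end
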